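import Literature.MathematicalPhysics.QuantumFieldTheory.BalabanImbrieJaffe1984to88.BIJ88IdentityB1p296Proof
import Literature.MathematicalPhysics.QuantumFieldTheory.Balaban1983to89.B1Eq333Decomposition

/-!
# `BalabanImbrieJaffe1984to88.BIJ88ExternalField298` — T. Bałaban, J. Imbrie, A. Jaffe, *Effective action and cluster properties of the
abelian Higgs model*, Commun. Math. Phys. **114** (1988) 257–315 [BalabanImbrieJaffe1988], Sect. 5.10 *The Interaction for the Fluctuation
Fields*, p. 298 [PDF 42], the EXTERNAL-FIELD REPLACEMENT and the kernel `w₈`.  The print, verbatim: *"Having made the scalar field translation,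
we regard the terms 𝒫_{k,loc}, R^{(k)}, Q^{(k)}, F^{(m̄)}_{k,loc} as polynomials in φ^{(k)}, A^{(k)}. We make some small changes and localizations
in order to obtain the standard form of the fluctuation field interaction in Λ₈^{(k)}.  We have the external field
a_kaL^{−2}G_{k,loc}(ũ_{k+1})Q^*_k(ũ_{k+1})Λ₇^{(k)}C^{(k)}_{loc}(u_{k+1})Q^*(u_{k+1})ψ appearing in the diagrams in 𝒫_{k,loc}, R^{(k)}, F^{(m̄)}_{k,loc}.
The first we leave alone, whereas in the second we localize the field to Λ̄₈^{(k)} and replace it with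
a_{k+1}L^{−2}G^η_{k+1,loc}(u_{k+1})Q^*_{k+1}(u_{k+1})ψ + w₈ψ.  The kernel w₈ is local and small with small derivatives and Hölder derivatives.
This is accomplished in the usual fashion by replacing G_{k,loc}(u_{k+1}), C^{(k)}_{loc}(u_{k+1}) with the corresponding operators with Neumann
boundary conditions on an r(e_k)-cube □. The propagator composition formula [7, Eq. (2.41)] is applied, and G^η_{k+1}(□, u_{k+1}) is localized
again."*  [7] = T. Bałaban, *(Higgs)₂,₃ quantum fields in a finite volume I*, CMP **85** (1982) [Balaban1982Higgs1], (2.41) p. 612: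
*"Q_{k+1}(A)G^ε_{k+1}(Ω,A) = (aa_k/a_{k+1})(L^kε)^{−2}Q(A)C^{(k),L^kε}(Ω,A)Q_k(A)G^ε_k(Ω,A). (2.41) … The formula (2.41) allows us to compose
the covariances appearing after the successive applications of renormalization transformations."* (kernel-proved in the tree: `B1RG242.StepData.display241`).

statement-level skeleton of published theorems with citation tags; proofs where landed; nothing here is a claim about the Yang–Mills mass gap

WHAT IS PROVED (theorems + one def with body; 0 `sorry`; no `Prop`-valued fact; standard axioms; the dry-run caught a by-name duplicate of
`display241_adj` — deleted, the tree's theorem is used).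
* §1 **THE p. 298 REPLACEMENT IS [7] (2.41) IN ADJOINT FORM** on the tree's one-step carrier `B1RG242.StepData` (rectangular matrices:
  `G_k = (H + αP_k)⁻¹`, `C^{(k)} = (βP + Δ^{(k)})⁻¹`, `Q_{k+1} = QQ_k`, `G_{k+1} = (H + γP_{k+1})⁻¹`, `γ = αβ/(α+β)`): the adjoint form
  `G_{k+1}Q^*_{k+1} = (α + β)·G_kQ^*_kC^{(k)}Q^*` and the operator identity `(αβ)·G_kQ^*_kC^{(k)}Q^* = γ·G_{k+1}Q^*_{k+1}` are ALREADY IN THE TREE as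
  [7] (3.42) p. 619 (`B1Eq333Decomposition.display241_adj` / `eq342_op`, the same replacement for B1's vector field) and are used BY NAME:
  `eq342_op` read right to left is the p. 298 replacement without localizations; in C2's letters (α = a_k, β = aL⁻², γ = a_{k+1}L⁻² with a_{k+1} = aa_k/(aL⁻² + a_k)
  of [7] (2.13): p02's `gamma_unit`) **`externalField_printed`**: `a_{k+1}L⁻²·G^η_{k+1}Q^*_{k+1} = a_k·aL⁻²·G_kQ^*_kC^{(k)}Q^*` — THE p. 298
  REPLACEMENT IS EXACT (w₈ = 0) for the unlocalized operators and no `Λ₇^{(k)}` cut; `externalField_aSeq` with the closed form a_k = `B1.aSeq a L k`.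
* §2 **`w8`** (def with body) — the kernel `w₈` AS THE PRINTED DIFFERENCE: the original external-field operator with the LOCALIZED propagators
  `G′ = G_{k,loc} = G_k(□) + D₁`, `C′ = C^{(k)}_{loc} = C^{(k)}(□) + E` and the cut `Λ₇^{(k)}`, the field localized to `Λ̄₈^{(k)}`, minus the
  replacement with `G′_{k+1} = G^η_{k+1,loc} = G^η_{k+1}(□) + D₂`; **`w8_eq`**: under the exact identity of §1 for the `□`-operators and the
  displayed RANGE LAW `Λ̄₈·G′Q^*_k·Λ₇ = Λ̄₈·G′Q^*_k` (the localized kernels have range smaller than the collar between `Λ̄₈^{(k)}` and `Λ₇^{(k)c}`,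
  (2.29)/(5.2.1)–(5.2.4)), `w₈ = Λ̄₈·[a_kaL⁻²·(D₁Q^*_kC′Q^* + G_kQ^*_kEQ^*) − a_{k+1}L⁻²·D₂Q^*_{k+1}]` — EACH TERM CARRIES EXACTLY ONE of the three
  printed differences (*"replacing G_{k,loc}, C^{(k)}_{loc} with the corresponding operators with Neumann boundary conditions on an r(e_k)-cube □ …
  G^η_{k+1}(□, u_{k+1}) is localized again"*); ring-letter form `w8_eq_ring`, carrier form **`w8_eq_stepData`** (§1 feeds the exactness).
* §3 **`norm_w8_le`** / `norm_w8_le_of_small` — *"The kernel w₈ is … small"*: in a normed ℝ-algebra (operator norm, sub-multiplicative),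
  `‖w₈‖ ≤ ‖Λ̄₈‖·(|c₁|(‖Q^*_k‖‖C′‖‖Q^*‖ + ‖G_k‖‖Q^*_k‖‖Q^*‖) + |c₂|‖Q^*_{k+1}‖)·δ` as soon as the three differences have norm `≤ δ` (the
  (2.31)/(2.47)-type smallness `O(e^{−cr(e_k)})` of rows C2.Eq2.31 / C2.Eq2.47 — hypotheses here, as in this seat's `BIJ88ScalarComposition311`).
HONEST SCOPE.  (i) One background field: [7]'s carrier has one `A`; the print's `Q^*_k(ũ_{k+1})` vs `Q^*(u_{k+1})` (`ũ_{k+1} = u_{k+1}·`fluctuation,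
(5.6.1)) is the `A^{(k)}`-dependence that Sect. 5.6 expands into vertices — not treated (the identity is used at `A^{(k)} = 0`, where `ũ_{k+1} =
u_{k+1}`).  (ii) *"local"*, *"small derivatives and Hölder derivatives"* of `w₈`: not treated (only the operator-norm size from the displayed
smallness of the differences).  (iii) The rest of Sect. 5.10 (the regrouping display defining `V^{(k)}` and `Σ_□W₃^{(k)}(□)`, the `W₃` estimate =
r16's leaf `IneqW3` + p36's `BIJ88W3Chain298`, the `F^{m̄}`/`F̃̃` split) is not in this file.  Nothing of B1–B16 beyond [7] (2.41)/(2.42)/(3.42) by name;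
NOT summit progress; NOT continuum; NOT Clay.
CITATION HEADER (lean-in-tree rule).  Part of the lit-balaban TYPED SKELETON (HOME `run/shared/lean/pub/lit-balaban/`), PHASE-2 proof seat p31
gen 13 (unit `lit-balaban-p31-g13`; TAKING #2 line HOME/STATUS.md 2026-08-22T07:4xZ, free-target protocol G.5-34(d), own lane = continuation of
gen 12's `BIJ88ScalarComposition311` (*"identity 2.42 from [7]"*, p. 311)).  Row served: **`C2.Def§5.10`** (owner r16,
`HOME/lit-balaban-r16/ROWS-C2-part2.md`: *"rest of §5.10 absent"*) — the first two displays of p. 298 and the three sentences quoted.  PDF held: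
`paper:balaban1988-cmp114-bij-abelian-higgs-effective-action` (journal page = PDF page + 256); p. 298 [PDF 42] re-read this session as an image
(`HOME/lit-balaban-r16/renders/cmp114/original-p042-x2.png`); [7] (2.41) p. 612 via the tree's `B1RG242` header (verbatim quotation there).
Imports p02's `BIJ88IdentityB1p296Proof` (→ `B1RG242`) and the tree's `B1Eq333Decomposition` ([7] (3.42)); sub-namespace `…BIJ88ExternalField298`; nothing re-declared, nothing restated.
-/

namespace Literature.MathematicalPhysics.QuantumFieldTheory.BalabanImbrieJaffe1984to88.BIJ88ExternalField298

open Literature.MathematicalPhysics.QuantumFieldTheory.Balaban1983to89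
open Literature.MathematicalPhysics.QuantumFieldTheory.Balaban1983to89.B1RG242
open BIJ88IdentityB1p296Proof (gamma_unit)
open Matrix

noncomputable section

/-! ## §1  [7] (2.41) in adjoint form: `G_{k+1}Q^*_{k+1} = (α + β)·G_kQ^*_kC^{(k)}Q^*` -/


section Printed

variable {ι κ ν : Type*} [Fintype ι] [Fintype κ] [Fintype ν] [DecidableEq ι] [DecidableEq κ] [DecidableEq ν]
variable (S : StepData ℝ ι κ ν)

/-- **The two p. 298 displays, with the printed letters** (C2's unit lattice: α = a_k, β = aL⁻², hence γ = a_{k+1}L⁻² with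
**a_{k+1} = aa_k/(aL⁻² + a_k)** of [7] (2.13), p02's `gamma_unit`): under `QQ^* = 1` and the two invertibility hypotheses,
`(a_{k+1}L⁻²)·G^η_{k+1}Q^*_{k+1} = (a_k·aL⁻²)·G_kQ^*_kC^{(k)}Q^*` — the operator of *"a_kaL^{−2}G_kQ^*_kC^{(k)}Q^*ψ"* IS the operator of
*"a_{k+1}L^{−2}G^η_{k+1}Q^*_{k+1}ψ"*. [cite: BalabanImbrieJaffe1988, p.298 (Sect. 5.10)] -/
theorem externalField_printed {a ak L : ℝ} (ha : 0 < a) (hak : 0 < ak) (hL : 0 < L) (hα : S.α = ak) (hβ : S.β = a * L⁻¹ ^ 2)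
    (hQ : S.Q * S.Qs = 1) (hG : IsUnit (S.H + S.α • S.Pk)) (hC : IsUnit (S.β • S.P + S.Δk)) :
    (a * ak / (a * (L ^ 2)⁻¹ + ak) * L⁻¹ ^ 2) • (S.Gk1 * S.Qk1s) = (ak * (a * L⁻¹ ^ 2)) • (S.Gk * S.Qks * S.Ck * S.Qs) := by
  have hαβ : S.α + S.β ≠ 0 := by rw [hα, hβ]; positivity
  have h := (B1Eq333Decomposition.eq342_op S hQ hαβ hG hC).symm
  rwa [gamma_unit S ha hak hL hα hβ, hα, hβ] at h

/-- The same with the closed form **a_k = `B1.aSeq a L k` = a(1 − L⁻²)(1 − L^{−2k})⁻¹** ([7] (2.15)) and **a_{k+1} = `B1.aSeq a L (k+1)`**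
(`B1.aSeq_succ` = [7] (2.13)), `1 ≤ k`, `L > 1`. [cite: BalabanImbrieJaffe1988, p.298 (Sect. 5.10)] -/
theorem externalField_aSeq {a L : ℝ} {k : ℕ} (ha : 0 < a) (hL : 1 < L) (hk : 1 ≤ k) (hα : S.α = B1.aSeq a L k)
    (hβ : S.β = a * L⁻¹ ^ 2) (hQ : S.Q * S.Qs = 1) (hG : IsUnit (S.H + S.α • S.Pk)) (hC : IsUnit (S.β • S.P + S.Δk)) :
    (B1.aSeq a L (k + 1) * L⁻¹ ^ 2) • (S.Gk1 * S.Qk1s) = (B1.aSeq a L k * (a * L⁻¹ ^ 2)) • (S.Gk * S.Qks * S.Ck * S.Qs) := by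
  rw [B1.aSeq_succ ha hL hk]
  exact externalField_printed S ha (B1.aSeq_pos ha hL hk) (lt_trans one_pos hL) hα hβ hQ hG hC

end Printed

/-! ## §2  The kernel `w₈` as the printed difference, and its decomposition into localization differences -/

section W8

variable {ι κ ν : Type*} [Fintype ι] [Fintype κ]

/-- **`w₈` (p. 298), DEFINED** as the printed difference: the original external-field operator with the localized propagators
`G′ = G_{k,loc}`, `C′ = C^{(k)}_{loc}` and the cut `Λ₇^{(k)}`, coefficient `c₁ = a_kaL⁻²`, the field localized to `Λ̄₈^{(k)}` (left factor
`Λ8`), MINUS the replacement `c₂·G′_{k+1}Q^*_{k+1}`, `G′_{k+1} = G^η_{k+1,loc}`, `c₂ = a_{k+1}L⁻²`: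
`w₈ := Λ̄₈·[c₁·G′Q^*_kΛ₇C′Q^* − c₂·G′_{k+1}Q^*_{k+1}]` — so that *"a_kaL^{−2}G_{k,loc}Q^*_kΛ₇C^{(k)}_{loc}Q^*ψ"* localized to `Λ̄₈` equals
*"a_{k+1}L^{−2}G^η_{k+1,loc}Q^*_{k+1}ψ + w₈ψ"* there by definition (`externalField_replaced`). [cite: BalabanImbrieJaffe1988, p.298 (Sect. 5.10)] -/
def w8 (Λ8 Gk' : Matrix ι ι ℝ) (Qks : Matrix ι κ ℝ) (Λ7 Ck' : Matrix κ κ ℝ) (Qs : Matrix κ ν ℝ) (Gk1' : Matrix ι ι ℝ)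
    (Qk1s : Matrix ι ν ℝ) (c₁ c₂ : ℝ) : Matrix ι ν ℝ :=
  Λ8 * (c₁ • (Gk' * Qks * Λ7 * Ck' * Qs) - c₂ • (Gk1' * Qk1s))

variable (Λ8 Gk' : Matrix ι ι ℝ) (Qks : Matrix ι κ ℝ) (Λ7 Ck' : Matrix κ κ ℝ) (Qs : Matrix κ ν ℝ) (Gk1' : Matrix ι ι ℝ)
  (Qk1s : Matrix ι ν ℝ) (c₁ c₂ : ℝ)

/-- **«… and replace it with a_{k+1}L^{−2}G^η_{k+1,loc}(u_{k+1})Q^*_{k+1}(u_{k+1})ψ + w₈ψ»** — the localized original operator IS the replacement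
plus `w₈` (definitional bookkeeping). [cite: BalabanImbrieJaffe1988, p.298 (Sect. 5.10)] -/
theorem externalField_replaced :
    Λ8 * (c₁ • (Gk' * Qks * Λ7 * Ck' * Qs)) = Λ8 * (c₂ • (Gk1' * Qk1s)) + w8 Λ8 Gk' Qks Λ7 Ck' Qs Gk1' Qk1s c₁ c₂ := by
  rw [w8, Matrix.mul_sub]
  abel

/-- **`w₈` DECOMPOSED — «This is accomplished in the usual fashion by replacing G_{k,loc}(u_{k+1}), C^{(k)}_{loc}(u_{k+1}) with the corresponding
operators with Neumann boundary conditions on an r(e_k)-cube □. The propagator composition formula [7, Eq. (2.41)] is applied, and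
G^η_{k+1}(□, u_{k+1}) is localized again.»**  With `G′ = G + D₁`, `C′ = C + E`, `G′_{k+1} = G₁ + D₂` (the three printed differences as data),
the exact identity `c₂·G₁Q^*_{k+1} = c₁·GQ^*_kCQ^*` for the `□`-operators (§1; [7] (3.42) `eq342_op`) and the range law
`Λ̄₈·G′Q^*_k·Λ₇ = Λ̄₈·G′Q^*_k` (hypothesis `hrange`):
`w₈ = Λ̄₈·[c₁·(D₁Q^*_kC′Q^* + GQ^*_kEQ^*) − c₂·D₂Q^*_{k+1}]` — each term carries exactly one localization difference.
[cite: BalabanImbrieJaffe1988, p.298 (Sect. 5.10)] -/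
theorem w8_eq (G : Matrix ι ι ℝ) (C : Matrix κ κ ℝ) (G₁ D₁ D₂ : Matrix ι ι ℝ) (E : Matrix κ κ ℝ)
    (hG' : Gk' = G + D₁) (hC' : Ck' = C + E) (hG1' : Gk1' = G₁ + D₂)
    (hexact : c₂ • (G₁ * Qk1s) = c₁ • (G * Qks * C * Qs)) (hrange : Λ8 * (Gk' * Qks * Λ7) = Λ8 * (Gk' * Qks)) :
    w8 Λ8 Gk' Qks Λ7 Ck' Qs Gk1' Qk1s c₁ c₂ = Λ8 * (c₁ • (D₁ * Qks * Ck' * Qs + G * Qks * E * Qs) - c₂ • (D₂ * Qk1s)) := by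
  have h1 : Λ8 * (Gk' * Qks * Λ7 * Ck' * Qs) = Λ8 * (Gk' * Qks * Ck' * Qs) := by
    have h := congrArg (· * (Ck' * Qs)) hrange
    simpa only [Matrix.mul_assoc] using h
  unfold w8
  rw [Matrix.mul_sub, Matrix.mul_smul, h1, hG1', Matrix.add_mul, smul_add, hexact, hG', hC']
  simp only [Matrix.mul_add, Matrix.add_mul, smul_add, Matrix.mul_smul, Matrix.mul_sub]
  abel

end W8

/-! ### The same bookkeeping with all letters in one ring (rectangular typing suppressed), for the norm bound -/

section Ring

variable {A : Type*} [Ring A] [Algebra ℝ A]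

/-- `w₈` decomposed, ring-letter form: `Λ8·(c₁·G′XΛ₇C′Y − c₂·G′₁Z) = Λ8·(c₁·(D₁XC′Y + GXEY) − c₂·D₂Z)` for `G′ = G + D₁`, `C′ = C + E`,
`G′₁ = G₁ + D₂`, under `c₂·G₁Z = c₁·GXCY` and `Λ8·G′X·Λ₇ = Λ8·G′X` (`X = Q^*_k`, `Y = Q^*`, `Z = Q^*_{k+1}`).
[cite: BalabanImbrieJaffe1988, p.298 (Sect. 5.10)] -/
theorem w8_eq_ring (c₁ c₂ : ℝ) (Λ8 Λ7 G D₁ C E G₁ D₂ X Y Z : A) (hexact : c₂ • (G₁ * Z) = c₁ • (G * X * C * Y))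
    (hrange : Λ8 * ((G + D₁) * X * Λ7) = Λ8 * ((G + D₁) * X)) :
    Λ8 * (c₁ • ((G + D₁) * X * Λ7 * (C + E) * Y) - c₂ • ((G₁ + D₂) * Z))
      = Λ8 * (c₁ • (D₁ * X * (C + E) * Y + G * X * E * Y) - c₂ • (D₂ * Z)) := by
  have h1 : Λ8 * ((G + D₁) * X * Λ7 * (C + E) * Y) = Λ8 * ((G + D₁) * X * (C + E) * Y) := by
    have h := congrArg (· * ((C + E) * Y)) hrange
    simpa only [mul_assoc] using h
  rw [mul_sub, mul_smul_comm, h1, add_mul G₁, smul_add, hexact]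
  simp only [mul_add, add_mul, smul_add, mul_smul_comm, mul_sub]
  abel

end Ring

/-! ## §3  *"The kernel w₈ is … small"*: the operator-norm size from the smallness of the three differences -/

section Norm

variable {A : Type*} [NormedRing A] [NormedAlgebra ℝ A]

omit [NormedAlgebra ℝ A] in
/-- kernel: sub-multiplicativity for four factors. [cite: BalabanImbrieJaffe1988, p.298 (Sect. 5.10)] -/
theorem norm_mul₄_le (a₁ a₂ a₃ a₄ : A) : ‖a₁ * a₂ * a₃ * a₄‖ ≤ ‖a₁‖ * ‖a₂‖ * ‖a₃‖ * ‖a₄‖ :=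
  calc ‖a₁ * a₂ * a₃ * a₄‖ ≤ ‖a₁ * a₂ * a₃‖ * ‖a₄‖ := norm_mul_le _ _
    _ ≤ ‖a₁ * a₂‖ * ‖a₃‖ * ‖a₄‖ := by gcongr; exact norm_mul_le _ _
    _ ≤ ‖a₁‖ * ‖a₂‖ * ‖a₃‖ * ‖a₄‖ := by gcongr; exact norm_mul_le _ _

/-- **Operator-norm bound of the decomposed `w₈`** (sub-multiplicative norm):
`‖Λ8·(c₁·(D₁XC′Y + GXEY) − c₂·D₂Z)‖ ≤ ‖Λ8‖·(|c₁|·(‖D₁‖‖X‖‖C′‖‖Y‖ + ‖G‖‖X‖‖E‖‖Y‖) + |c₂|·‖D₂‖‖Z‖)`.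
[cite: BalabanImbrieJaffe1988, p.298 (Sect. 5.10)] -/
theorem norm_w8_le (c₁ c₂ : ℝ) (Λ8 G D₁ C' E D₂ X Y Z : A) :
    ‖Λ8 * (c₁ • (D₁ * X * C' * Y + G * X * E * Y) - c₂ • (D₂ * Z))‖
      ≤ ‖Λ8‖ * (|c₁| * (‖D₁‖ * ‖X‖ * ‖C'‖ * ‖Y‖ + ‖G‖ * ‖X‖ * ‖E‖ * ‖Y‖) + |c₂| * (‖D₂‖ * ‖Z‖)) := by
  calc ‖Λ8 * (c₁ • (D₁ * X * C' * Y + G * X * E * Y) - c₂ • (D₂ * Z))‖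
      ≤ ‖Λ8‖ * ‖c₁ • (D₁ * X * C' * Y + G * X * E * Y) - c₂ • (D₂ * Z)‖ := norm_mul_le _ _
    _ ≤ ‖Λ8‖ * (‖c₁ • (D₁ * X * C' * Y + G * X * E * Y)‖ + ‖c₂ • (D₂ * Z)‖) := by gcongr; exact norm_sub_le _ _
    _ = ‖Λ8‖ * (|c₁| * ‖D₁ * X * C' * Y + G * X * E * Y‖ + |c₂| * ‖D₂ * Z‖) := by
        rw [norm_smul, norm_smul, Real.norm_eq_abs, Real.norm_eq_abs]
    _ ≤ ‖Λ8‖ * (|c₁| * (‖D₁ * X * C' * Y‖ + ‖G * X * E * Y‖) + |c₂| * (‖D₂‖ * ‖Z‖)) := by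
        gcongr
        · exact norm_add_le _ _
        · exact norm_mul_le _ _
    _ ≤ ‖Λ8‖ * (|c₁| * (‖D₁‖ * ‖X‖ * ‖C'‖ * ‖Y‖ + ‖G‖ * ‖X‖ * ‖E‖ * ‖Y‖) + |c₂| * (‖D₂‖ * ‖Z‖)) := by
        gcongr <;> exact norm_mul₄_le _ _ _ _

/-- **«The kernel w₈ is … small»**: if the three printed differences are small in operator norm — `‖G_{k,loc} − G_k(□)‖ ≤ δ`,
`‖C^{(k)}_{loc} − C^{(k)}(□)‖ ≤ δ`, `‖G^η_{k+1,loc} − G^η_{k+1}(□)‖ ≤ δ` (the (2.31)/(2.47)-type inputs `O(e^{−cr(e_k)})`, rows C2.Eq2.31 /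
C2.Eq2.47; hypotheses here) — then `‖w₈‖ ≤ ‖Λ̄₈‖·(|c₁|(‖Q^*_k‖‖C′‖‖Q^*‖ + ‖G_k‖‖Q^*_k‖‖Q^*‖) + |c₂|‖Q^*_{k+1}‖)·δ`; with `δ = e^{−cr(e_k)}`
the printed order. [cite: BalabanImbrieJaffe1988, p.298 (Sect. 5.10)] -/
theorem norm_w8_le_of_small (c₁ c₂ : ℝ) {Λ8 G D₁ C' E D₂ X Y Z : A} {δ : ℝ} (hD₁ : ‖D₁‖ ≤ δ) (hE : ‖E‖ ≤ δ) (hD₂ : ‖D₂‖ ≤ δ) :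
    ‖Λ8 * (c₁ • (D₁ * X * C' * Y + G * X * E * Y) - c₂ • (D₂ * Z))‖
      ≤ ‖Λ8‖ * (|c₁| * (‖X‖ * ‖C'‖ * ‖Y‖ + ‖G‖ * ‖X‖ * ‖Y‖) + |c₂| * ‖Z‖) * δ := by
  refine (norm_w8_le c₁ c₂ Λ8 G D₁ C' E D₂ X Y Z).trans ?_
  have h1 : ‖D₁‖ * ‖X‖ * ‖C'‖ * ‖Y‖ ≤ δ * ‖X‖ * ‖C'‖ * ‖Y‖ := by gcongr
  have h2 : ‖G‖ * ‖X‖ * ‖E‖ * ‖Y‖ ≤ ‖G‖ * ‖X‖ * δ * ‖Y‖ := by gcongr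
  have h3 : ‖D₂‖ * ‖Z‖ ≤ δ * ‖Z‖ := by gcongr
  have hc₁ : 0 ≤ |c₁| := abs_nonneg c₁
  have hc₂ : 0 ≤ |c₂| := abs_nonneg c₂
  have hΛ : 0 ≤ ‖Λ8‖ := norm_nonneg _
  have hsum : |c₁| * (‖D₁‖ * ‖X‖ * ‖C'‖ * ‖Y‖ + ‖G‖ * ‖X‖ * ‖E‖ * ‖Y‖) + |c₂| * (‖D₂‖ * ‖Z‖)
      ≤ |c₁| * (δ * ‖X‖ * ‖C'‖ * ‖Y‖ + ‖G‖ * ‖X‖ * δ * ‖Y‖) + |c₂| * (δ * ‖Z‖) := by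
    gcongr
  calc ‖Λ8‖ * (|c₁| * (‖D₁‖ * ‖X‖ * ‖C'‖ * ‖Y‖ + ‖G‖ * ‖X‖ * ‖E‖ * ‖Y‖) + |c₂| * (‖D₂‖ * ‖Z‖))
      ≤ ‖Λ8‖ * (|c₁| * (δ * ‖X‖ * ‖C'‖ * ‖Y‖ + ‖G‖ * ‖X‖ * δ * ‖Y‖) + |c₂| * (δ * ‖Z‖)) :=
        mul_le_mul_of_nonneg_left hsum hΛ
    _ = ‖Λ8‖ * (|c₁| * (‖X‖ * ‖C'‖ * ‖Y‖ + ‖G‖ * ‖X‖ * ‖Y‖) + |c₂| * ‖Z‖) * δ := by ring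

end Norm

/-! ## §4  Knitting: `w₈` on [7]'s carrier with the exactness fed by §1 -/

section Knit

variable {ι κ ν : Type*} [Fintype ι] [Fintype κ] [Fintype ν] [DecidableEq ι] [DecidableEq κ] [DecidableEq ν]
variable (S : StepData ℝ ι κ ν)

/-- **`w₈` ON THE ONE-STEP CARRIER, DECOMPOSED, EXACTNESS DISCHARGED**: with the `□`-operators `G_k = S.Gk`, `C^{(k)} = S.Ck`, `G^η_{k+1} = S.Gk1`,
`Q^*_k = S.Qks`, `Q^* = S.Qs`, `Q^*_{k+1} = S.Qk1s` of [7]'s carrier (`QQ^* = 1`, `α + β ≠ 0`, invertibility of the arguments of (2.20), (2.30)),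
the localized `G_{k,loc} = G_k + D₁`, `C^{(k)}_{loc} = C^{(k)} + E`, `G^η_{k+1,loc} = G^η_{k+1} + D₂`, coefficients `c₁ = αβ` (= a_k·aL⁻²),
`c₂ = γ` (= a_{k+1}L⁻²) and the range law: `w₈ = Λ̄₈·[αβ·(D₁Q^*_kC_{loc}Q^* + G_kQ^*_kEQ^*) − γ·D₂Q^*_{k+1}]` — [7] (2.41)/(3.42)
`B1Eq333Decomposition.eq342_op` supplies the exact part BY NAME. [cite: BalabanImbrieJaffe1988, p.298 (Sect. 5.10)] -/
theorem w8_eq_stepData (hQ : S.Q * S.Qs = 1) (hαβ : S.α + S.β ≠ 0) (hG : IsUnit (S.H + S.α • S.Pk))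
    (hC : IsUnit (S.β • S.P + S.Δk)) (Λ8 D₁ D₂ : Matrix ι ι ℝ) (Λ7 E : Matrix κ κ ℝ)
    (hrange : Λ8 * ((S.Gk + D₁) * S.Qks * Λ7) = Λ8 * ((S.Gk + D₁) * S.Qks)) :
    w8 Λ8 (S.Gk + D₁) S.Qks Λ7 (S.Ck + E) S.Qs (S.Gk1 + D₂) S.Qk1s (S.α * S.β) S.γ
      = Λ8 * ((S.α * S.β) • (D₁ * S.Qks * (S.Ck + E) * S.Qs + S.Gk * S.Qks * E * S.Qs) - S.γ • (D₂ * S.Qk1s)) :=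
  w8_eq Λ8 (S.Gk + D₁) S.Qks Λ7 (S.Ck + E) S.Qs (S.Gk1 + D₂) S.Qk1s (S.α * S.β) S.γ S.Gk S.Ck S.Gk1 D₁ D₂ E rfl rfl rfl
    (B1Eq333Decomposition.eq342_op S hQ hαβ hG hC).symm hrange

/-- … hence, when all three differences vanish (exact `□`-operators) and the range law holds, `w₈ = 0`: the replacement of p. 298 is an identity.
[cite: BalabanImbrieJaffe1988, p.298 (Sect. 5.10)] -/
theorem w8_eq_zero_of_exact (hQ : S.Q * S.Qs = 1) (hαβ : S.α + S.β ≠ 0) (hG : IsUnit (S.H + S.α • S.Pk))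
    (hC : IsUnit (S.β • S.P + S.Δk)) (Λ8 : Matrix ι ι ℝ) (Λ7 : Matrix κ κ ℝ)
    (hrange : Λ8 * (S.Gk * S.Qks * Λ7) = Λ8 * (S.Gk * S.Qks)) :
    w8 Λ8 S.Gk S.Qks Λ7 S.Ck S.Qs S.Gk1 S.Qk1s (S.α * S.β) S.γ = 0 := by
  have h := w8_eq_stepData S hQ hαβ hG hC Λ8 0 0 Λ7 0 (by simpa using hrange)
  simpa using h

end Knit

end

end Literature.MathematicalPhysics.QuantumFieldTheory.BalabanImbrieJaffe1984to88.BIJ88ExternalField298
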